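import Literature.Analysis.FunctionSpaces.LittlewoodPaleyInhomogeneousProofs
import Mathlib.Analysis.SpecialFunctions.JapaneseBracket
import HarnessLib

/-!
# `B^s_{∞,∞} = C^{0,s}_b` for `0 < s < 1` (Triebel 1983, Thm. 2.5.7): discharge of the named fact
`memBesov_top_top_iff_memBoundedHolder`

Sibling proof file of `Literature/Analysis/FunctionSpaces/LittlewoodPaley.lean` (blocks
`Literature.Analysis.FunctionSpaces.lpBlock = Δ̇_j`, cut-offs
`Literature.Analysis.FunctionSpaces.lowFreqCutoff = Ṡ_j`, `L^p` norms of distributions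
`Literature.Analysis.FunctionSpaces.eLpNormDistrib`, the inhomogeneous class
`Literature.Analysis.FunctionSpaces.MemBesov` — finite
`‖Ṡ₀ u‖_{L^p} + ‖(2^{js} ‖Δ̇_j u‖_{L^p})_{j ≥ 1}‖_{ℓ^q}`) and of
`Literature/Analysis/FunctionSpaces/HolderNorm.lean` (the bounded Hölder class
`Literature.Analysis.FunctionSpaces.MemBoundedHolder r f`: `sup ‖f‖ + [f]_r < ∞`), continuing
`LittlewoodPaleyDifferenceProofs.lean` (translations as Fourier multipliers `τ_h = e_h(D)`, the
low-frequency estimate `‖(e_h - 1)(D) Δ̇_j u‖_{L^p} ≲ 2^j ‖h‖ ‖Δ̇_j u‖_{L^p}`, the dyadic sum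
`∑_j min(2^j t, 1)(2^j t)^{-s} ≤ K`, the mean-zero kernel `k₀` of `Δ̇₀`) and
`LittlewoodPaleyInhomogeneousProofs.lean` (`Ṡ₀` is bounded on `L^p`). It settles the named fact
`Literature.Analysis.FunctionSpaces.memBesov_top_top_iff_memBoundedHolder` of `LittlewoodPaley.lean`:

* **Triebel 1983, Theorem 2.5.7 (ii)**: `𝒞^s(ℝⁿ) = B^s_{∞,∞}(ℝⁿ)` for `s > 0`, together with
  **(2.5.7/9)**: `C^s(ℝⁿ) = 𝒞^s(ℝⁿ)` for `0 < s ∉ ℕ`, where for `0 < s < 1` the Hölder space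
  `C^s(ℝⁿ)` is (2.2.2/3) the space of bounded uniformly continuous `f` with
  `‖f‖_∞ + sup_{x ≠ y} |f(x) - f(y)| / |x - y|^s < ∞` (held copy, PDF pp. 151–152 for the
  definitions, pp. 218–220 for §2.5.7; the same identity is Corollary 2.5.12 (ii), eq. (22),
  PDF p. 245, proved there through differences).

In the tree's form: for `0 < s < 1`, a tempered distribution `u ∈ 𝓢'(E, F)` satisfies
`MemBesov s ∞ ∞ u` iff `u` is the distribution of some `f : E → F` with `MemLp f ∞` and
`MemBoundedHolder ⟨s, _⟩ f` (bounded and `s`-Hölder **everywhere**; such `f` are uniformly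
continuous, so this is exactly Triebel's `C^s`).

## Main results (everything here is proved)

* `Literature.Analysis.FunctionSpaces.memBesov_top_top_coe_of_memBoundedHolder`:
  **`C^{0,s}_b ⊂ B^s_{∞,∞}`** (any `s > 0`): `Ṡ₀ f ∈ L^∞` and `2^{js} ‖Δ̇_j f‖_{L^∞} ≤ [f]_s M_s` for
  all `j ∈ ℤ` (`Literature.Analysis.FunctionSpaces.eLpNormDistrib_lpBlock_coe_le_of_holderWith`),
  `M_s = ∫ |k₀(t)| ‖t‖^s dt`.
* `Literature.Analysis.FunctionSpaces.exists_memBoundedHolder_coe_eq_of_memBesov_top_top`: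
  **`B^s_{∞,∞} ⊂ C^{0,s}_b`** for `0 < s < 1`, with an explicit continuous representative.
* `Literature.Analysis.FunctionSpaces.memBesov_top_top_iff_memBoundedHolder_holds :
  memBesov_top_top_iff_memBoundedHolder` — the discharge, valid for every finite-dimensional `E`
  (including `E = {0}`, where both sides say `u ∈ L^∞`) and every complex Banach space `F`.

## The proof

* (`§ AeToEverywhere`, `§ SchwartzConvolution`) **Continuous representatives.** For a Schwartz
  symbol `Ψ` and `g ∈ L^∞`, `(𝓕⁻¹Ψ) ⋆ g` is continuous (dominated convergence with the Schwartz
  decay `|𝓕⁻¹Ψ(z)| ≲ (1 + ‖z‖)^{-d-1}`), lies in `L^∞`, and represents `Ψ(D) g`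
  (`Literature.Analysis.FunctionSpaces.fourierMultiplierCLM_coe_apply_eq_integral_convolution`).
  For a *continuous* `L^∞` representative `φ` of a distribution `w`, almost-everywhere bounds
  become everywhere bounds (Lebesgue measure charges open sets): `‖φ(x)‖ ≤ ‖w‖_{L^∞}` and
  `‖φ(x + h) - φ(x)‖ ≤ ‖(e_h - 1)(D) w‖_{L^∞}` for **all** `x`
  (`Literature.Analysis.FunctionSpaces.fourierMultiplierCLM_translSymbol_sub_one_coe`: the
  multiplier `(e_h - 1)(D)` is the finite difference `τ_h - 1` on `L^p`).
* (`§ SymbolAlgebra`, `§ LowFreqTranslation`) **Bernstein on the ball, translation form**: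
  `Ṡ₀ = Ṡ₁ Ṡ₀` (`χ(ξ/2) χ(ξ) = χ(ξ)`), hence `(e_h - 1)(D) Ṡ₀ u = Ψ_h(D) Ṡ₀ u` with the Schwartz
  symbol `Ψ_h = (e_h - 1) χ(·/2)` whose seminorms are `≲ 2π‖h‖` when `2π‖h‖ ≤ 1`
  (`Literature.Analysis.FunctionSpaces.norm_iteratedFDeriv_translSymbol_rescaled_sub_one_le`,
  `Literature.Analysis.FunctionSpaces.seminorm_smulLeftCLM_le_of_bound_on`), so
  `‖𝓕⁻¹Ψ_h‖_{L¹} ≲ 2π‖h‖` (`Literature.Analysis.FunctionSpaces.exists_eLpNorm_fourierInv_le`) and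
  Young's inequality give `‖(e_h - 1)(D) Ṡ₀ u‖_{L^p} ≤ C (2π‖h‖) ‖Ṡ₀ u‖_{L^p}` — Triebel's
  "(1.4.1/3) (first derivatives): every `F⁻¹ φ_k F f` is uniformly continuous" (proof of
  Prop. 2.5.7, Step 1) in quantitative form.
* (`§ HolderToBesov`) **`C^{0,s}_b ⊂ B^s_{∞,∞}`.** `Δ̇₀ g = k₀ ⋆ g` and `∫ k₀ = 0`, so
  `(k₀ ⋆ g)(x) = ∫ k₀(t) (g(x - t) - g(x)) dt` and `|(k₀ ⋆ g)(x)| ≤ [g]_s ∫ |k₀(t)| ‖t‖^s dt` for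
  every `x`; the general block follows by the dyadic scaling
  `Δ̇_j f = (Δ̇₀ f(2^{-j}·))(2^j ·)` of `LittlewoodPaleyProofs.lean`
  (`Literature.Analysis.FunctionSpaces.lpBlock_distribDilate_holds`,
  `Literature.Analysis.FunctionSpaces.eLpNormDistrib_distribDilate`), `f(2^{-j}·)` being
  `s`-Hölder with constant `[f]_s 2^{-js}`; `Ṡ₀ f ∈ L^∞` is
  `Literature.Analysis.FunctionSpaces.eLpNormDistrib_lowFreqCutoff_coe_lt_top`.
* (`§ BesovToHolder`) **`B^s_{∞,∞} ⊂ C^{0,s}_b`** (Triebel's proof of Prop. 2.5.7, Step 1,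
  `B⁰_{∞,1} ⊂ C`: the series `f = ∑_k F⁻¹ φ_k F f` converges in `L^∞` and every term is bounded
  and uniformly continuous "by (1.4.1/3) (first derivatives)"; here run with the weights `2^{js}`). With `a₀ = ‖Ṡ₀ u‖_{L^∞}` and
  `‖Δ̇_j u‖_{L^∞} ≤ 2^{-js} N` (`j ≥ 1`), take continuous representatives `φ₀` of `Ṡ₀ u = Ṡ₁ Ṡ₀ u`
  and `φ_j` of `Δ̇_j u = ψ_j(D) Δ̇_j u` (`ψ_j = ψ(2^{-j}·)` the reproducing symbol,
  `Literature.Analysis.FunctionSpaces.lpBlock_eq_fourierMultiplierCLM_bernsteinSymbol_rescaled`) and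
  set `f = φ₀ + ∑_{j ≥ 1} φ_j` (normally convergent). Then `‖f‖_∞ ≤ a₀ + ∑_j 2^{-js} N`, and for
  `t = 2π‖h‖`: `‖φ_j(x + h) - φ_j(x)‖ ≤ min(C 2^j t, 2) 2^{-js} N`
  (`Literature.Analysis.FunctionSpaces.exists_eLpNormDistrib_translSymbol_sub_one_lpBlock_le`,
  `Literature.Analysis.FunctionSpaces.eLpNormDistrib_translSymbol_sub_one_le_two_mul`), whose sum
  over `j` is `≲ t^s N` (`Literature.Analysis.FunctionSpaces.exists_tsum_min_mul_rpow_neg_le`; this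
  is where `s < 1` enters), while `‖φ₀(x + h) - φ₀(x)‖ ≤ min(C t, 2) a₀ ≲ t^s a₀` (`§ LowFreqTranslation`).
  Finally `[f] = u`: the partial sums represent `Ṡ₀ u + ∑_{j=1}^m Δ̇_j u = Ṡ_m u → u` in `𝓢'`
  (`Literature.Analysis.FunctionSpaces.tendsto_lowFreqCutoff_atTop_distribution`) and converge to
  `f` in `L^∞`, hence in `𝓢'` (`MeasureTheory.Lp.toTemperedDistributionCLM` is continuous);
  limits in `𝓢'` are unique.

## References

* H. Triebel, *Theory of Function Spaces*, Monographs in Mathematics 78, Birkhäuser (1983),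
  doi:10.1007/978-3-0346-0416-1 (held): §2.2.2, eqs. (3), (6) (the spaces `C^s`, `𝒞^s`);
  §2.5.7, Proposition (`B⁰_{∞,1} ⊂ C ⊂ B⁰_{∞,∞}`) and Theorem (ii), eq. (6), with eq. (9)
  (`C^s = 𝒞^s = B^s_{∞,∞}`, `0 < s ∉ ℕ`); §2.5.12, Corollary (ii), eq. (22).
  [cite: Triebel1983, Thm. 2.5.7]
* H. Bahouri, J.-Y. Chemin, R. Danchin, *Fourier Analysis and Nonlinear Partial Differential
  Equations*, Grundlehren 343, Springer (2011), doi:10.1007/978-3-642-16830-7: Lemma 2.1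
  (Bernstein) and Thm. 2.36 with its proof (finite differences versus dyadic blocks) — the
  machinery of `LittlewoodPaleyDifferenceProofs.lean` reused here.
  [cite: BahouriCheminDanchin2011, Thm. 2.36]
-/

noncomputable section

open MeasureTheory TemperedDistribution SchwartzMap Filter Topology Function
open scoped SchwartzMap ENNReal NNReal FourierTransform Real Convolution

namespace Literature.Analysis.FunctionSpaces

/-! ## From almost-everywhere bounds to everywhere bounds for continuous functions -/

section AeToEverywhere

variable {X : Type*} [TopologicalSpace X] [MeasurableSpace X] {μ : Measure X}
  [μ.IsOpenPosMeasure] {Y : Type*} [NormedAddCommGroup Y]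

/-- A continuous function which is bounded by `C` almost everywhere for a measure charging every
nonempty open set is bounded by `C` everywhere (the exceptional set is open and null, hence empty).
[folklore] -/
theorem forall_enorm_le_of_ae_enorm_le {g : X → Y} (hg : Continuous g) {C : ℝ≥0∞}
    (h : ∀ᵐ x ∂μ, ‖g x‖ₑ ≤ C) (x : X) : ‖g x‖ₑ ≤ C := by
  have hopen : IsOpen {x | ‖g x‖ₑ ≤ C}ᶜ :=
    (isClosed_le (continuous_enorm.comp hg) continuous_const).isOpen_compl
  have hnull : μ {x | ‖g x‖ₑ ≤ C}ᶜ = 0 := by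
    rw [ae_iff] at h
    exact h
  have hempty : ({x | ‖g x‖ₑ ≤ C}ᶜ : Set X) = ∅ := (hopen.measure_eq_zero_iff μ).1 hnull
  by_contra hx
  have hmem : x ∈ ({x | ‖g x‖ₑ ≤ C}ᶜ : Set X) := hx
  rw [hempty] at hmem
  exact hmem

end AeToEverywhere

/-! ## Continuity of the convolution of a Schwartz kernel with a bounded function -/

section SchwartzConvolution

variable {E : Type*} [NormedAddCommGroup E] [InnerProductSpace ℝ E] [FiniteDimensional ℝ E]
  [MeasurableSpace E] [BorelSpace E] {F : Type*} [NormedAddCommGroup F] [NormedSpace ℂ F]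

omit [MeasurableSpace E] [BorelSpace E] [FiniteDimensional ℝ E] in
/-- Polynomial decay of a Schwartz function: `‖K z‖ ≤ C (1 + ‖z‖)^{-N}`. [folklore] -/
theorem exists_norm_le_mul_inv_one_add_norm_pow (K : 𝓢(E, ℂ)) (N : ℕ) :
    ∃ C : ℝ, 0 ≤ C ∧ ∀ z : E, ‖K z‖ ≤ C * ((1 + ‖z‖) ^ N)⁻¹ := by
  refine ⟨2 ^ N * (Finset.Iic (N, 0)).sup (fun m => SchwartzMap.seminorm ℂ m.1 m.2) K,
    by positivity, fun z => ?_⟩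
  have h := one_add_le_sup_seminorm_apply (𝕜 := ℂ) (m := (N, 0)) (k := N) (n := 0) le_rfl le_rfl K z
  rw [norm_iteratedFDeriv_zero, mul_comm] at h
  have hpos : 0 < (1 + ‖z‖) ^ N := by positivity
  rwa [le_mul_inv_iff₀ hpos]

omit [InnerProductSpace ℝ E] [FiniteDimensional ℝ E] [MeasurableSpace E] [BorelSpace E] in
/-- On the unit ball around `x₀`: `(1 + ‖x - y‖)^{-N} ≤ 2^N (1 + ‖y - x₀‖)^{-N}`. [folklore] -/
theorem inv_one_add_norm_sub_pow_le_of_norm_sub_le_one {x x₀ y : E} (hx : ‖x - x₀‖ ≤ 1) (N : ℕ) :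
    ((1 + ‖x - y‖) ^ N)⁻¹ ≤ 2 ^ N * ((1 + ‖y - x₀‖) ^ N)⁻¹ := by
  have h1 : 1 + ‖y - x₀‖ ≤ 2 * (1 + ‖x - y‖) := by
    have : ‖y - x₀‖ ≤ ‖x - y‖ + ‖x - x₀‖ := by
      calc ‖y - x₀‖ = ‖(x - x₀) - (x - y)‖ := by congr 1; abel
        _ ≤ ‖x - x₀‖ + ‖x - y‖ := norm_sub_le _ _
        _ = ‖x - y‖ + ‖x - x₀‖ := add_comm _ _
    have h0 := norm_nonneg (x - y)
    linarith
  have hpos : 0 < (1 + ‖y - x₀‖) ^ N := by positivity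
  have hpos' : 0 < (1 + ‖x - y‖) ^ N := by positivity
  rw [← div_eq_mul_inv, le_div_iff₀ hpos]
  calc ((1 + ‖x - y‖) ^ N)⁻¹ * (1 + ‖y - x₀‖) ^ N
      ≤ ((1 + ‖x - y‖) ^ N)⁻¹ * (2 * (1 + ‖x - y‖)) ^ N := by gcongr
    _ = 2 ^ N := by rw [mul_pow, mul_left_comm, inv_mul_cancel₀ hpos'.ne', mul_one]

/-- **The convolution of a Schwartz kernel with an (essentially) bounded measurable function is
continuous** (dominated convergence: near `x₀` the integrand `K(x - y) g(y)` is dominated by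
`C 2^{d+1} (1 + ‖y - x₀‖)^{-(d+1)} ‖g‖_∞`, which is integrable). [folklore] -/
theorem continuous_schwartz_convolution_of_ae_bound (K : 𝓢(E, ℂ)) {g : E → F}
    (hg : AEStronglyMeasurable g volume) {M : ℝ} (hM : ∀ᵐ y ∂volume, ‖g y‖ ≤ M) :
    Continuous ((⇑K) ⋆[ContinuousLinearMap.lsmul ℂ ℂ, volume] g) := by
  set d : ℕ := Module.finrank ℝ E with hd
  obtain ⟨C, hC0, hC⟩ := exists_norm_le_mul_inv_one_add_norm_pow K (d + 1)
  have hconv : (⇑K) ⋆[ContinuousLinearMap.lsmul ℂ ℂ, volume] g = fun x => ∫ y, K (x - y) • g y := by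
    funext x
    rw [convolution_lsmul_swap]
  rw [hconv]
  refine continuous_iff_continuousAt.2 fun x₀ => ?_
  have hM0 : 0 ≤ max M 0 := le_max_right _ _
  refine continuousAt_of_dominated
    (bound := fun y => C * (2 ^ (d + 1) * ((1 + ‖y - x₀‖) ^ (d + 1))⁻¹) * max M 0) ?_ ?_ ?_ ?_
  · exact Eventually.of_forall fun x =>
      (K.continuous.comp (continuous_const.sub continuous_id)).aestronglyMeasurable.smul hg
  · have hball : ∀ᶠ x in 𝓝 x₀, ‖x - x₀‖ ≤ 1 := by
      filter_upwards [Metric.closedBall_mem_nhds x₀ one_pos] with x hx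
      rwa [Metric.mem_closedBall, dist_eq_norm] at hx
    filter_upwards [hball] with x hx
    filter_upwards [hM] with y hy
    rw [norm_smul]
    refine mul_le_mul ((hC _).trans ?_) (hy.trans (le_max_left _ _)) (norm_nonneg _)
      (by positivity)
    exact mul_le_mul_of_nonneg_left (inv_one_add_norm_sub_pow_le_of_norm_sub_le_one hx (d + 1)) hC0
  · have h1 : Integrable (fun y : E => ((1 + ‖y - x₀‖) ^ (d + 1))⁻¹) volume := by
      have h2 : Integrable (fun y : E => (1 + ‖y‖) ^ (-((d : ℝ) + 1))) volume :=
        integrable_one_add_norm (by rw [← hd]; linarith)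
      have h3 : Integrable (fun y : E => ((1 + ‖y‖) ^ (d + 1))⁻¹) volume := by
        refine h2.congr (ae_of_all _ fun y => ?_)
        simp only
        rw [Real.rpow_neg (by positivity), ← Real.rpow_natCast]
        push_cast
        ring_nf
      exact h3.comp_sub_right x₀
    exact ((h1.const_mul _).const_mul C).mul_const _
  · exact Eventually.of_forall fun y =>
      ((K.continuous.comp (continuous_id.sub continuous_const)).smul continuous_const).continuousAt

variable [CompleteSpace F]

/-- **Continuous representatives.** For a Schwartz symbol `Ψ` and `g ∈ L^∞(E; F)` the function
`(𝓕⁻¹Ψ) ⋆ g` is continuous, lies in `L^∞`, and its class represents the tempered distribution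
`Ψ(D) g` (`Literature.Analysis.FunctionSpaces.fourierMultiplierCLM_coe_apply_eq_integral_convolution`).
[folklore] -/
theorem exists_continuous_memLp_top_coe_eq_fourierMultiplierCLM (Ψ : 𝓢(E, ℂ))
    (g : Lp F ∞ (volume : Measure E)) :
    ∃ φ : E → F, Continuous φ ∧ ∃ hφ : MemLp φ ∞ (volume : Measure E),
      ((hφ.toLp φ : Lp F ∞ (volume : Measure E)) : 𝓢'(E, F)) =
        fourierMultiplierCLM F (⇑Ψ) (g : 𝓢'(E, F)) := by
  set K : 𝓢(E, ℂ) := 𝓕⁻ Ψ with hKdef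
  have hK : AEStronglyMeasurable (⇑K) (volume : Measure E) := K.continuous.aestronglyMeasurable
  have hgm : AEStronglyMeasurable (g : E → F) volume := Lp.aestronglyMeasurable g
  have hφ : MemLp ((⇑K) ⋆[ContinuousLinearMap.lsmul ℂ ℂ, volume] (g : E → F)) ∞ volume :=
    memLp_convolution_smul (K.integrable (μ := volume)) (Lp.memLp g) le_top
  have hM : ∀ᵐ y ∂volume, ‖(g : E → F) y‖ ≤ (eLpNormEssSup (g : E → F) volume).toReal := by
    have hfin : eLpNormEssSup (g : E → F) volume ≠ ⊤ := by
      rw [← eLpNorm_exponent_top]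
      exact (Lp.memLp g).eLpNorm_ne_top
    filter_upwards [enorm_ae_le_eLpNormEssSup (g : E → F) volume] with y hy
    calc ‖(g : E → F) y‖ = (‖(g : E → F) y‖ₑ).toReal := by rw [toReal_enorm]
      _ ≤ (eLpNormEssSup (g : E → F) volume).toReal := ENNReal.toReal_mono hfin hy
  refine ⟨_, continuous_schwartz_convolution_of_ae_bound K hgm hM, hφ, ?_⟩
  ext u
  rw [Lp.toTemperedDistribution_apply, fourierMultiplierCLM_coe_apply_eq_integral_convolution]
  refine integral_congr_ae ?_
  filter_upwards [hφ.coeFn_toLp] with y hy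
  rw [hy]

/-- A continuous `L^∞` representative is bounded **everywhere** by the `L^∞` norm of the
distribution it represents. [folklore] -/
theorem enorm_le_eLpNormDistrib_coe_toLp {φ : E → F} (hφc : Continuous φ)
    (hφ : MemLp φ ∞ (volume : Measure E)) (x : E) :
    ‖φ x‖ₑ ≤ eLpNormDistrib ∞ ((hφ.toLp φ : Lp F ∞ (volume : Measure E)) : 𝓢'(E, F)) := by
  rw [eLpNormDistrib_coe, Lp.enorm_toLp, eLpNorm_exponent_top]
  exact forall_enorm_le_of_ae_enorm_le hφc (enorm_ae_le_eLpNormEssSup φ volume) x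

/-- The increments of a continuous `L^∞` representative are bounded **everywhere** by the `L^∞`
norm of the distributional finite difference `(e_h - 1)(D) φ = τ_h φ - φ`
(`Literature.Analysis.FunctionSpaces.fourierMultiplierCLM_translSymbol_sub_one_coe`). [folklore] -/
theorem enorm_sub_le_eLpNormDistrib_translSymbol_sub_one_coe_toLp {φ : E → F} (hφc : Continuous φ)
    (hφ : MemLp φ ∞ (volume : Measure E)) (h x : E) :
    ‖φ (x + h) - φ x‖ₑ ≤ eLpNormDistrib ∞ (fourierMultiplierCLM F (fun ξ : E => translSymbol h ξ - 1)
      ((hφ.toLp φ : Lp F ∞ (volume : Measure E)) : 𝓢'(E, F))) := by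
  rw [fourierMultiplierCLM_translSymbol_sub_one_coe, eLpNormDistrib_coe, enorm_lpTranslate_sub]
  have hae : (fun y => (hφ.toLp φ : E → F) (y + h) - (hφ.toLp φ : E → F) y) =ᵐ[volume]
      fun y => φ (y + h) - φ y := by
    filter_upwards [hφ.coeFn_toLp,
      (measurePreserving_add_right (volume : Measure E) h).quasiMeasurePreserving.ae_eq_comp
        hφ.coeFn_toLp] with y hy hy'
    simp only [Function.comp_apply] at hy'
    rw [hy, hy']
  rw [eLpNorm_congr_ae hae, eLpNorm_exponent_top]
  exact forall_enorm_le_of_ae_enorm_le (g := fun y => φ (y + h) - φ y)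
    ((hφc.comp (continuous_id.add continuous_const)).sub hφc)
    (enorm_ae_le_eLpNormEssSup (fun y => φ (y + h) - φ y) volume) x

end SchwartzConvolution


/-! ## Symbol algebra: `Ṡ₁ Ṡ₀ = Ṡ₀`, and the rescaled reproducing symbol of `Δ̇_j` -/

section SymbolAlgebra

variable {E : Type*} [NormedAddCommGroup E] [InnerProductSpace ℝ E]

/-- `χ(ξ) ≠ 0 ⟹ ‖ξ‖ < 2` (the cut-off is supported in the open ball of radius `2`). [folklore] -/
theorem norm_lt_two_of_dyadicCutoff_ne_zero {ξ : E} (h : dyadicCutoff E ξ ≠ 0) : ‖ξ‖ < 2 := by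
  by_contra hle
  exact h (dyadicCutoff_apply_of_two_le_norm (not_lt.1 hle))

/-- `χ(ξ/2) χ(ξ) = χ(ξ)`: the symbol identity behind `Ṡ₁ Ṡ₀ = Ṡ₀` (`χ(ξ/2) = 1` on `‖ξ‖ ≤ 2 ⊇ supp χ`).
[folklore] -/
theorem lowFreqSymbol_zero_mul_lowFreqSymbol_one :
    (lowFreqSymbol 0 : E → ℂ) * lowFreqSymbol 1 = lowFreqSymbol 0 := by
  funext ξ
  simp only [Pi.mul_apply]
  have h0 : lowFreqSymbol (E := E) 0 ξ = ((dyadicCutoff E ξ : ℝ) : ℂ) := by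
    simp [lowFreqSymbol]
  by_cases h : dyadicCutoff E ξ = 0
  · rw [h0, h, Complex.ofReal_zero, zero_mul]
  · have hξ : ‖ξ‖ ≤ (2 : ℝ) ^ (1 : ℤ) := by
      rw [zpow_one]
      exact (norm_lt_two_of_dyadicCutoff_ne_zero h).le
    rw [lowFreqSymbol_eq_one_of_norm_le hξ, mul_one]

/-- The support of `χ(2^{-1} ·)` lies in the closed ball of radius `4`. [folklore] -/
theorem tsupport_lowFreqSymbol_one_subset :
    tsupport (lowFreqSymbol (E := E) 1) ⊆ Metric.closedBall (0 : E) 4 := by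
  refine closure_minimal (fun ξ hξ => ?_) Metric.isClosed_closedBall
  rw [Function.mem_support] at hξ
  rw [Metric.mem_closedBall, dist_zero_right]
  have h1 : dyadicCutoff E (((2 : ℝ) ^ (-(1 : ℤ))) • ξ) ≠ 0 := by
    intro h
    apply hξ
    change (((dyadicCutoff E (((2 : ℝ) ^ (-(1 : ℤ))) • ξ)) : ℝ) : ℂ) = 0
    rw [h, Complex.ofReal_zero]
  have h2 := norm_lt_two_of_dyadicCutoff_ne_zero h1
  rw [norm_two_zpow_smul] at h2
  have : (2 : ℝ) ^ (-(1 : ℤ)) = 2⁻¹ := by norm_num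
  rw [this] at h2
  linarith

variable [FiniteDimensional ℝ E]

/-- The rescaled reproducing symbol `ψ_j = ψ(2^{-j} ·)` of the block `Δ̇_j` is (the underlying
function of) a Schwartz function (smooth with compact support; `Δ̇_j = ψ_j(D) Δ̇_j`,
`Literature.Analysis.FunctionSpaces.lpBlock_eq_fourierMultiplierCLM_bernsteinSymbol_rescaled`).
[folklore] -/
theorem exists_schwartzMap_coe_eq_bernsteinSymbol_rescaled (j : ℤ) :
    ∃ Ψ : 𝓢(E, ℂ), (Ψ : E → ℂ) = fun ξ : E => bernsteinSymbol (((2 : ℝ) ^ (-j)) • ξ) :=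
  ⟨(hasCompactSupport_bernsteinSymbol.comp_smul (zpow_ne_zero (-j) (two_ne_zero' ℝ))).toSchwartzMap
    (contDiff_bernsteinSymbol.comp (contDiff_const_smul _)), rfl⟩

variable [MeasurableSpace E] [BorelSpace E] {F : Type*} [NormedAddCommGroup F] [NormedSpace ℂ F]

/-- `Ṡ₁ Ṡ₀ = Ṡ₀` on `𝓢'(E, F)`. [folklore] -/
theorem lowFreqCutoff_one_lowFreqCutoff_zero (u : 𝓢'(E, F)) :
    lowFreqCutoff 1 (lowFreqCutoff 0 u) = lowFreqCutoff 0 u := by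
  rw [lowFreqCutoff_apply, lowFreqCutoff_apply,
    TemperedDistribution.fourierMultiplierCLM_fourierMultiplierCLM_apply
      (hasTemperateGrowth_lowFreqSymbol 0) (hasTemperateGrowth_lowFreqSymbol 1),
    lowFreqSymbol_zero_mul_lowFreqSymbol_one]

end SymbolAlgebra

/-! ## Bernstein on the ball: `‖τ_h Ṡ₀ u - Ṡ₀ u‖_{L^p} ≲ ‖h‖ ‖Ṡ₀ u‖_{L^p}` -/

section LowFreqTranslation

variable {E : Type*} [NormedAddCommGroup E] [InnerProductSpace ℝ E] [FiniteDimensional ℝ E]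
  [MeasurableSpace E] [BorelSpace E] {F : Type*} [NormedAddCommGroup F] [NormedSpace ℂ F]
  [CompleteSpace F]

/-- **Low-frequency finite differences** (Bernstein's inequality on the ball, translation form;
Triebel 1983, proof of Prop. 2.5.7, Step 1: "by (1.4.1/3) (first derivatives) every
`F⁻¹ φ_k F f` is … uniformly continuous"): there is `C` such that for all `h` with `2π‖h‖ ≤ 1` and every
`u ∈ 𝓢'(E, F)`, `‖(e_h - 1)(D) Ṡ₀ u‖_{L^p} ≤ C (2π‖h‖) ‖Ṡ₀ u‖_{L^p}` (`1 ≤ p ≤ ∞`). Proof: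
`Ṡ₀ = Ṡ₁ Ṡ₀`, so `(e_h - 1)(D) Ṡ₀ u = Ψ_h(D) Ṡ₀ u` with the Schwartz symbol `Ψ_h = (e_h - 1) χ(·/2)`,
whose seminorms are `≲ 2π‖h‖` (`|e^{iθ} - 1| ≤ |θ|` and `supp χ(·/2) ⊆ {‖ξ‖ ≤ 4}`), whence
`‖𝓕⁻¹Ψ_h‖_{L¹} ≲ 2π‖h‖` and Young's inequality. [folklore] -/
theorem exists_eLpNormDistrib_translSymbol_sub_one_lowFreqCutoff_zero_le (p : ℝ≥0∞) [hp : Fact (1 ≤ p)] :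
    ∃ C : ℝ≥0, ∀ h : E, 2 * π * ‖h‖ ≤ 1 → ∀ u : 𝓢'(E, F),
      eLpNormDistrib p (fourierMultiplierCLM F (fun ξ : E => translSymbol h ξ - 1) (lowFreqCutoff 0 u)) ≤
        C * ENNReal.ofReal (2 * π * ‖h‖) * eLpNormDistrib p (lowFreqCutoff 0 u) := by
  obtain ⟨s, C₀, h₀⟩ := exists_eLpNorm_fourierInv_le (E := E)
  set n : ℕ := s.sup Prod.snd with hn
  set θ : 𝓢(E, ℂ) := lowFreqSymbolSchwartz E 1 with hθ
  set A : ℝ := ∑ i ∈ s, 2 ^ i.2 * (Finset.Iic i).sup (schwartzSeminormFamily ℂ E ℂ) θ with hA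
  have hA0 : 0 ≤ A := Finset.sum_nonneg fun i _ => by positivity
  refine ⟨C₀ * (A * 4).toNNReal + 1, fun h hh u => ?_⟩
  have hS : tsupport (θ : E → ℂ) ⊆ Metric.closedBall (0 : E) 4 := by
    rw [hθ, coe_lowFreqSymbolSchwartz]
    exact tsupport_lowFreqSymbol_one_subset
  set g : E → ℂ := fun ξ : E => translSymbol h ξ - 1 with hgdef
  have hg : g.HasTemperateGrowth := hasTemperateGrowth_translSymbol_sub_one h
  set a : ℝ := 2 * π * ‖h‖ with ha
  have ha0 : 0 ≤ a := by positivity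
  have hB : ∀ N ≤ n, ∀ x ∈ Metric.closedBall (0 : E) 4, ‖iteratedFDeriv ℝ N g x‖ ≤ 4 * a := by
    intro N _ x hx
    rw [Metric.mem_closedBall, dist_zero_right] at hx
    have h1 := norm_iteratedFDeriv_translSymbol_rescaled_sub_one_le h 0 (by simpa using hh) N hx
    simpa [hgdef, ha] using h1
  -- the Schwartz symbol `Ψ = (e_h - 1) χ(·/2)` and its seminorms
  set Ψ : 𝓢(E, ℂ) := SchwartzMap.smulLeftCLM ℂ g θ with hΨ
  have hΨcoe : (lowFreqSymbol 1 : E → ℂ) * g = ⇑Ψ := by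
    rw [hΨ, SchwartzMap.smulLeftCLM_apply hg, hθ, coe_lowFreqSymbolSchwartz]
    funext ξ
    simp only [Pi.mul_apply, smul_eq_mul, mul_comm]
  have hsemi : ∀ i ∈ s, schwartzSeminormFamily ℂ E ℂ i Ψ ≤
      2 ^ i.2 * (Finset.Iic i).sup (schwartzSeminormFamily ℂ E ℂ) θ * (4 * a) := by
    intro i hi
    have hin : i.2 ≤ n := Finset.le_sup (f := Prod.snd) hi
    have h := seminorm_smulLeftCLM_le_of_bound_on hg hS (n := i.2) (by positivity : (0 : ℝ) ≤ 4 * a)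
      (fun N hN x hx => hB N (hN.trans hin) x hx) i.1
    calc schwartzSeminormFamily ℂ E ℂ i Ψ = SchwartzMap.seminorm ℂ i.1 i.2 Ψ := rfl
      _ ≤ 2 ^ i.2 * (4 * a) * (Finset.Iic (i.1, i.2)).sup (schwartzSeminormFamily ℂ E ℂ) θ := h
      _ = 2 ^ i.2 * (Finset.Iic i).sup (schwartzSeminormFamily ℂ E ℂ) θ * (4 * a) := by
          rw [Prod.mk.eta]; ring
  have hsup : s.sup (schwartzSeminormFamily ℂ E ℂ) Ψ ≤ A * (4 * a) := by
    refine Seminorm.finset_sup_apply_le (by positivity) fun i hi => (hsemi i hi).trans ?_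
    rw [hA, Finset.sum_mul]
    exact Finset.single_le_sum (f := fun i => 2 ^ i.2 *
      (Finset.Iic i).sup (schwartzSeminormFamily ℂ E ℂ) θ * (4 * a))
      (fun j _ => by positivity) hi
  have hK1 : eLpNorm (⇑(𝓕⁻ Ψ : 𝓢(E, ℂ))) 1 volume ≤ (C₀ * (A * 4).toNNReal : ℝ≥0) * ENNReal.ofReal a := by
    calc eLpNorm (⇑(𝓕⁻ Ψ : 𝓢(E, ℂ))) 1 volume ≤ C₀ * ENNReal.ofReal (s.sup (schwartzSeminormFamily ℂ E ℂ) Ψ) :=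
          h₀ Ψ
      _ ≤ C₀ * ENNReal.ofReal (A * 4 * a) := by
          gcongr
          calc s.sup (schwartzSeminormFamily ℂ E ℂ) Ψ ≤ A * (4 * a) := hsup
            _ = A * 4 * a := by ring
      _ = (C₀ * (A * 4).toNNReal : ℝ≥0) * ENNReal.ofReal a := by
          rw [ENNReal.ofReal_mul (by positivity), ENNReal.coe_mul, mul_assoc]
          rfl
  -- `(e_h - 1)(D) Ṡ₀ u = (e_h - 1)(D) Ṡ₁ Ṡ₀ u = Ψ(D) Ṡ₀ u`
  have hop : fourierMultiplierCLM F g (lowFreqCutoff 0 u) = fourierMultiplierCLM F (⇑Ψ) (lowFreqCutoff 0 u) := by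
    conv_lhs => rw [← lowFreqCutoff_one_lowFreqCutoff_zero u, lowFreqCutoff_apply]
    rw [TemperedDistribution.fourierMultiplierCLM_fourierMultiplierCLM_apply
      (hasTemperateGrowth_lowFreqSymbol 1) hg, hΨcoe]
  rw [hop]
  by_cases hrep : ∃ f : Lp F p (volume : Measure E), (f : 𝓢'(E, F)) = lowFreqCutoff 0 u
  · obtain ⟨f, hf⟩ := hrep
    rw [← hf]
    calc eLpNormDistrib p (fourierMultiplierCLM F (⇑Ψ) (f : 𝓢'(E, F)))
        ≤ eLpNorm (⇑(𝓕⁻ Ψ : 𝓢(E, ℂ))) 1 volume * ‖f‖ₑ := eLpNormDistrib_fourierMultiplierCLM_coe_le Ψ f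
      _ ≤ (C₀ * (A * 4).toNNReal : ℝ≥0) * ENNReal.ofReal a * ‖f‖ₑ := by gcongr
      _ ≤ ((C₀ * (A * 4).toNNReal + 1 : ℝ≥0) : ℝ≥0∞) * ENNReal.ofReal a * ‖f‖ₑ := by
          gcongr
          exact le_self_add
      _ = ((C₀ * (A * 4).toNNReal + 1 : ℝ≥0) : ℝ≥0∞) * ENNReal.ofReal a *
            eLpNormDistrib p (f : 𝓢'(E, F)) := by
          rw [eLpNormDistrib_coe]
  · push Not at hrep
    rw [eLpNormDistrib_of_forall_ne hrep]
    rcases ha0.eq_or_lt with ha00 | hapos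
    · -- `h = 0`: the symbol vanishes, and so does the operator
      have hh0 : h = 0 := by
        rw [ha] at ha00
        have : ‖h‖ = 0 := by
          by_contra hne
          have : 0 < 2 * π * ‖h‖ := mul_pos Real.two_pi_pos ((norm_nonneg h).lt_of_ne' hne)
          linarith
        exact norm_eq_zero.1 this
      have hg0 : g = fun _ => (0 : ℂ) := by
        funext ξ
        simp [hgdef, hh0, translSymbol_apply]
      have hΨ0 : Ψ = 0 := by
        ext ξ
        rw [← hΨcoe, hg0]
        simp
      have hop0 : fourierMultiplierCLM F (⇑Ψ) (lowFreqCutoff 0 u) = 0 := by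
        rw [hΨ0]
        ext φ
        rw [fourierMultiplierCLM_apply_apply]
        have h00 : SchwartzMap.smulLeftCLM ℂ (⇑(0 : 𝓢(E, ℂ))) (𝓕⁻ φ) = 0 := by
          ext x
          rw [SchwartzMap.smulLeftCLM_apply (0 : 𝓢(E, ℂ)).hasTemperateGrowth]
          simp
        rw [h00, FourierTransform.fourier_zero, map_zero]
        rfl
      rw [hop0, eLpNormDistrib_zero]
      exact bot_le
    · rw [ENNReal.mul_top (mul_ne_zero (by simp) (ENNReal.ofReal_pos.2 hapos).ne')]
      exact le_top

end LowFreqTranslation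


/-! ## Hölder functions have Littlewood–Paley blocks of size `2^{-js}` in `L^∞` -/

section HolderToBesov

variable {E : Type*} [NormedAddCommGroup E] [InnerProductSpace ℝ E] [FiniteDimensional ℝ E]
  [MeasurableSpace E] [BorelSpace E] {F : Type*} [NormedAddCommGroup F] [NormedSpace ℂ F]

/-- The `s`-th moment `M_s = ∫ |k₀(t)| ‖t‖^s dt` of the kernel `k₀ = 𝓕⁻¹φ₀` of `Δ̇₀` is finite for
`0 ≤ s` (Schwartz decay of `k₀`). [folklore] -/
theorem lintegral_enorm_dyadicKernel_mul_enorm_rpow_lt_top {s : ℝ} (hs : 0 ≤ s) :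
    ∫⁻ t, ‖(dyadicKernel E) t‖ₑ * ‖t‖ₑ ^ s < ⊤ := by
  refine lt_of_le_of_lt (le_of_eq (lintegral_congr fun t => ?_))
    (lintegral_enorm_mul_ofReal_norm_rpow_lt_top (dyadicKernel E) hs)
  rw [← ofReal_norm t, ENNReal.ofReal_rpow_of_nonneg (norm_nonneg _) hs]

variable [CompleteSpace F]

/-- **The block `Δ̇₀` of a Hölder function, pointwise**: if `‖g(x - t) - g(x)‖ ≤ C ‖t‖^s` for all
`x, t` (and `g` is bounded and measurable), then `‖(k₀ ⋆ g)(x)‖ ≤ C M_s` for **every** `x`, because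
`∫ k₀ = 0` gives `(k₀ ⋆ g)(x) = ∫ k₀(t) (g(x - t) - g(x)) dt` (Triebel 1983, proof of Thm. 2.5.12,
Step 1; BCD, proof of Thm. 2.36). [folklore] -/
theorem enorm_dyadicKernel_convolution_le_of_holder {g : E → F} (hgm : AEStronglyMeasurable g volume)
    {B : ℝ} (hB : ∀ x, ‖g x‖ ≤ B) {s : ℝ} {C : ℝ≥0∞}
    (hC : ∀ x t : E, ‖g (x - t) - g x‖ₑ ≤ C * ‖t‖ₑ ^ s) (x : E) :
    ‖((⇑(dyadicKernel E)) ⋆[ContinuousLinearMap.lsmul ℂ ℂ, volume] g) x‖ₑ ≤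
      C * ∫⁻ t, ‖(dyadicKernel E) t‖ₑ * ‖t‖ₑ ^ s := by
  set k : 𝓢(E, ℂ) := dyadicKernel E with hk
  have hgx : AEStronglyMeasurable (fun t => g (x - t)) (volume : Measure E) :=
    hgm.comp_measurePreserving (Measure.measurePreserving_sub_left volume x)
  have hint : Integrable (fun t => k t • g (x - t)) (volume : Measure E) := by
    refine Integrable.mono' (g := fun t => ‖k t‖ * B) ((k.integrable (μ := volume)).norm.mul_const B)
      (k.continuous.aestronglyMeasurable.smul hgx) (Eventually.of_forall fun t => ?_)
    rw [norm_smul]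
    exact mul_le_mul_of_nonneg_left (hB _) (norm_nonneg _)
  have hconst : Integrable (fun t => k t • g x) (volume : Measure E) :=
    (k.integrable (μ := volume)).smul_const _
  have hzero : ∫ t, k t • g x = 0 := by
    rw [integral_smul_const, hk, integral_dyadicKernel, zero_smul]
  have hrepr : ((⇑k) ⋆[ContinuousLinearMap.lsmul ℂ ℂ, volume] g) x = ∫ t, k t • (g (x - t) - g x) := by
    rw [convolution_def]
    simp only [ContinuousLinearMap.lsmul_apply, smul_sub]
    rw [integral_sub hint hconst, hzero, sub_zero]
  rw [hrepr]
  refine (enorm_integral_le_lintegral_enorm _).trans ?_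
  have hm : AEMeasurable (fun t : E => ‖k t‖ₑ * ‖t‖ₑ ^ s) volume :=
    k.continuous.aestronglyMeasurable.enorm.mul (measurable_enorm.pow_const s).aemeasurable
  calc ∫⁻ t, ‖k t • (g (x - t) - g x)‖ₑ = ∫⁻ t, ‖k t‖ₑ * ‖g (x - t) - g x‖ₑ := by
        simp_rw [enorm_smul]
    _ ≤ ∫⁻ t, C * (‖k t‖ₑ * ‖t‖ₑ ^ s) := lintegral_mono fun t => by
        rw [mul_left_comm]
        gcongr
        exact hC x t
    _ = C * ∫⁻ t, ‖(dyadicKernel E) t‖ₑ * ‖t‖ₑ ^ s := by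
        rw [lintegral_const_mul'' _ hm]

/-- **`‖Δ̇₀ g‖_{L^∞} ≤ C M_s`** for a continuous bounded `g` with `‖g(x - t) - g(x)‖ ≤ C‖t‖^s`
(`Δ̇₀ g = k₀ ⋆ g` as distributions). [folklore] -/
theorem eLpNormDistrib_lpBlock_zero_coe_le_of_holder {g : E → F} (hgc : Continuous g) {B : ℝ}
    (hB : ∀ x, ‖g x‖ ≤ B) {s : ℝ} {C : ℝ≥0∞} (hC : ∀ x t : E, ‖g (x - t) - g x‖ₑ ≤ C * ‖t‖ₑ ^ s)
    (hg : MemLp g ∞ (volume : Measure E)) :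
    eLpNormDistrib ∞ (lpBlock 0 ((hg.toLp g : Lp F ∞ (volume : Measure E)) : 𝓢'(E, F))) ≤
      C * ∫⁻ t, ‖(dyadicKernel E) t‖ₑ * ‖t‖ₑ ^ s := by
  set k : 𝓢(E, ℂ) := dyadicKernel E with hk
  set v : Lp F ∞ (volume : Measure E) := hg.toLp g with hv
  have hconv : MemLp ((⇑k) ⋆[ContinuousLinearMap.lsmul ℂ ℂ, volume] (v : E → F)) ∞ volume :=
    memLp_convolution_smul (k.integrable (μ := volume)) (Lp.memLp v) le_top
  have hrep : ((hconv.toLp _ : Lp F ∞ (volume : Measure E)) : 𝓢'(E, F)) = lpBlock 0 (v : 𝓢'(E, F)) := by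
    rw [lpBlock_apply, ← coe_dyadicSchwartz]
    ext u
    rw [Lp.toTemperedDistribution_apply, fourierMultiplierCLM_coe_apply_eq_integral_convolution]
    refine integral_congr_ae ?_
    filter_upwards [hconv.coeFn_toLp] with y hy
    rw [hy]
    rfl
  have hae : (⇑k) ⋆[ContinuousLinearMap.lsmul ℂ ℂ, volume] (v : E → F) =
      (⇑k) ⋆[ContinuousLinearMap.lsmul ℂ ℂ, volume] g :=
    convolution_congr _ EventuallyEq.rfl hg.coeFn_toLp
  calc eLpNormDistrib ∞ (lpBlock 0 (v : 𝓢'(E, F)))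
      ≤ ‖(hconv.toLp _ : Lp F ∞ (volume : Measure E))‖ₑ := by rw [← hrep]; exact eLpNormDistrib_coe_le _
    _ = eLpNorm ((⇑k) ⋆[ContinuousLinearMap.lsmul ℂ ℂ, volume] (v : E → F)) ∞ volume :=
        Lp.enorm_toLp hconv
    _ = eLpNormEssSup ((⇑k) ⋆[ContinuousLinearMap.lsmul ℂ ℂ, volume] g) volume := by
        rw [hae, eLpNorm_exponent_top]
    _ ≤ C * ∫⁻ t, ‖(dyadicKernel E) t‖ₑ * ‖t‖ₑ ^ s :=
        eLpNormEssSup_le_of_ae_enorm_bound (Eventually.of_forall fun x =>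
          enorm_dyadicKernel_convolution_le_of_holder hgc.aestronglyMeasurable hB hC x)

/-- **`‖Δ̇_j f‖_{L^∞} ≤ C 2^{-js} M_s` for a bounded `s`-Hölder function** (`0 < s`), all `j ∈ ℤ`
(Triebel 1983, proof of Thm. 2.5.12, Step 1 / BCD, proof of Thm. 2.36, first inequality, at `p = ∞`):
from `j = 0` by the dyadic scaling `Δ̇_j f = (Δ̇₀ f(2^{-j}·))(2^j ·)`, `f(2^{-j}·)` being `s`-Hölder with
constant `C 2^{-js}`, and `‖w(2^j ·)‖_{L^∞} = ‖w‖_{L^∞}`. [folklore] -/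
theorem eLpNormDistrib_lpBlock_coe_le_of_holderWith {s : ℝ} (hs : 0 < s) {f : E → F} {C : ℝ≥0}
    {B : ℝ} (hC : HolderWith C ⟨s, hs.le⟩ f) (hB : ∀ x, ‖f x‖ ≤ B)
    (hf : MemLp f ∞ (volume : Measure E)) (j : ℤ) :
    eLpNormDistrib ∞ (lpBlock j ((hf.toLp f : Lp F ∞ (volume : Measure E)) : 𝓢'(E, F))) ≤
      C * (2 : ℝ≥0∞) ^ (-((j : ℝ) * s)) * ∫⁻ t, ‖(dyadicKernel E) t‖ₑ * ‖t‖ₑ ^ s := by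
  have hfc : Continuous f := hC.continuous hs
  set c : ℝˣ := Units.mk0 ((2 : ℝ) ^ j) (zpow_ne_zero j two_ne_zero) with hc
  have hcinv : ((c⁻¹ : ℝˣ) : ℝ) = (2 : ℝ) ^ (-j) := by
    rw [Units.val_inv_eq_inv_val, zpow_neg]; rfl
  have ha : (2 : ℝ) ^ (-j) ≠ 0 := zpow_ne_zero _ two_ne_zero
  -- the rescaled function `f(2^{-j} ·)`
  set fc : E → F := fun x => f (((2 : ℝ) ^ (-j)) • x) with hfc_def
  have hfcc : Continuous fc := hfc.comp (continuous_const_smul _)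
  have hfcB : ∀ x, ‖fc x‖ ≤ B := fun x => hB _
  have hfcm : MemLp fc ∞ (volume : Measure E) :=
    memLp_top_of_bound hfcc.aestronglyMeasurable B (Eventually.of_forall hfcB)
  have hfcH : ∀ x t : E, ‖fc (x - t) - fc x‖ₑ ≤ (C * (2 : ℝ≥0∞) ^ (-((j : ℝ) * s))) * ‖t‖ₑ ^ s := by
    intro x t
    have h1 : ‖f (((2 : ℝ) ^ (-j)) • (x - t)) - f (((2 : ℝ) ^ (-j)) • x)‖ₑ ≤
        C * (‖(2 : ℝ) ^ (-j)‖ₑ * ‖t‖ₑ) ^ s := by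
      have := hC (((2 : ℝ) ^ (-j)) • (x - t)) (((2 : ℝ) ^ (-j)) • x)
      rwa [edist_eq_enorm_sub, edist_eq_enorm_sub, ← smul_sub, sub_sub_cancel_left, smul_neg, enorm_neg,
        enorm_smul] at this
    calc ‖fc (x - t) - fc x‖ₑ = ‖f (((2 : ℝ) ^ (-j)) • (x - t)) - f (((2 : ℝ) ^ (-j)) • x)‖ₑ := rfl
      _ ≤ C * (‖(2 : ℝ) ^ (-j)‖ₑ * ‖t‖ₑ) ^ s := h1
      _ = (C * (2 : ℝ≥0∞) ^ (-((j : ℝ) * s))) * ‖t‖ₑ ^ s := by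
          rw [ENNReal.mul_rpow_of_nonneg _ _ hs.le, Real.enorm_eq_ofReal (zpow_nonneg zero_le_two _),
            ENNReal.ofReal_rpow_of_nonneg (zpow_nonneg zero_le_two _) hs.le, ofReal_two_zpow_rpow,
            show (((-j : ℤ) : ℝ) * s) = -((j : ℝ) * s) by push_cast; ring, mul_assoc]
  -- `Δ̇_j f` through the dilation
  have hw : distribDilate c⁻¹ ((hf.toLp f : Lp F ∞ (volume : Measure E)) : 𝓢'(E, F)) =
      ((hfcm.toLp fc : Lp F ∞ (volume : Measure E)) : 𝓢'(E, F)) := by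
    refine distribDilate_coe_holds c⁻¹ (hf.toLp f) (hfcm.toLp fc) ?_
    rw [hcinv]
    filter_upwards [hfcm.coeFn_toLp,
      (Measure.quasiMeasurePreserving_smul (volume : Measure E) ha).ae_eq_comp hf.coeFn_toLp]
      with x hx hx'
    simp only [Function.comp_apply] at hx'
    rw [hx, hx']
  have hblock : lpBlock j ((hf.toLp f : Lp F ∞ (volume : Measure E)) : 𝓢'(E, F)) =
      distribDilate c (lpBlock 0 ((hfcm.toLp fc : Lp F ∞ (volume : Measure E)) : 𝓢'(E, F))) := by
    conv_lhs => rw [← distribDilate_distribDilate_inv c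
      ((hf.toLp f : Lp F ∞ (volume : Measure E)) : 𝓢'(E, F)), hc, lpBlock_distribDilate_holds j j, sub_self]
    rw [← hc, hw]
  rw [hblock, eLpNormDistrib_distribDilate, one_div, ENNReal.inv_top, ENNReal.toReal_zero,
    ENNReal.rpow_zero, one_mul]
  exact eLpNormDistrib_lpBlock_zero_coe_le_of_holder hfcc hfcB hfcH hfcm

/-- **Bounded Hölder functions lie in `B^s_{∞,∞}`** (Triebel 1983, Thm. 2.5.7 (ii) with (2.5.7/9),
the inclusion `C^s ⊂ B^s_{∞,∞}`, `0 < s < 1`; the proof only uses `0 < s`): for `f ∈ C^{0,s}_b`,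
`Ṡ₀ f ∈ L^∞` (`Ṡ₀` is bounded on `L^∞`) and `2^{js} ‖Δ̇_j f‖_{L^∞} ≤ [f]_s M_s` for all `j`.
[cite: Triebel1983, Thm. 2.5.7] -/
theorem memBesov_top_top_coe_of_memBoundedHolder {s : ℝ} (hs₀ : 0 < s) {f : E → F}
    (hf : MemLp f ∞ (volume : Measure E)) (hH : MemBoundedHolder ⟨s, hs₀.le⟩ f) :
    MemBesov s ∞ ∞ ((hf.toLp f : Lp F ∞ (volume : Measure E)) : 𝓢'(E, F)) := by
  obtain ⟨⟨B, hB⟩, ⟨C, hC⟩⟩ := memBoundedHolder_iff.1 hH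
  unfold MemBesov eBesovNorm
  refine ENNReal.add_lt_top.2 ⟨eLpNormDistrib_lowFreqCutoff_coe_lt_top 0 _, ?_⟩
  have hbound : ∀ n : ℕ, lpBlockWeightSucc s ∞
      ((hf.toLp f : Lp F ∞ (volume : Measure E)) : 𝓢'(E, F)) n ≤ C * ∫⁻ t, ‖(dyadicKernel E) t‖ₑ * ‖t‖ₑ ^ s := by
    intro n
    simp only [lpBlockWeightSucc, lpBlockWeight]
    calc (2 : ℝ≥0∞) ^ ((((n : ℤ) + 1 : ℤ) : ℝ) * s) *
          eLpNormDistrib ∞ (lpBlock ((n : ℤ) + 1) ((hf.toLp f : Lp F ∞ (volume : Measure E)) : 𝓢'(E, F)))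
        ≤ (2 : ℝ≥0∞) ^ ((((n : ℤ) + 1 : ℤ) : ℝ) * s) *
            (C * (2 : ℝ≥0∞) ^ (-((((n : ℤ) + 1 : ℤ) : ℝ) * s)) * ∫⁻ t, ‖(dyadicKernel E) t‖ₑ * ‖t‖ₑ ^ s) := by
          gcongr
          exact eLpNormDistrib_lpBlock_coe_le_of_holderWith hs₀ hC hB hf _
      _ = C * ((2 : ℝ≥0∞) ^ ((((n : ℤ) + 1 : ℤ) : ℝ) * s) *
            (2 : ℝ≥0∞) ^ (-((((n : ℤ) + 1 : ℤ) : ℝ) * s))) * ∫⁻ t, ‖(dyadicKernel E) t‖ₑ * ‖t‖ₑ ^ s := by ring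
      _ = C * ∫⁻ t, ‖(dyadicKernel E) t‖ₑ * ‖t‖ₑ ^ s := by
          rw [two_rpow_mul_two_rpow, add_neg_cancel, ENNReal.rpow_zero, mul_one]
  calc eLpNorm (lpBlockWeightSucc s ∞ ((hf.toLp f : Lp F ∞ (volume : Measure E)) : 𝓢'(E, F))) ∞
        Measure.count
      = ⨆ n, lpBlockWeightSucc s ∞ ((hf.toLp f : Lp F ∞ (volume : Measure E)) : 𝓢'(E, F)) n := by
        rw [eLpNorm_exponent_top, eLpNormEssSup_count]
        simp only [enorm_eq_self]
    _ ≤ C * ∫⁻ t, ‖(dyadicKernel E) t‖ₑ * ‖t‖ₑ ^ s := iSup_le hbound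
    _ < ⊤ := ENNReal.mul_lt_top ENNReal.coe_lt_top (lintegral_enorm_dyadicKernel_mul_enorm_rpow_lt_top hs₀.le)

end HolderToBesov


/-! ## `B^s_{∞,∞} ⊂ C^{0,s}_b`: the continuous representative and its Hölder modulus -/

section BesovToHolder

variable {E : Type*} [NormedAddCommGroup E] [InnerProductSpace ℝ E] [FiniteDimensional ℝ E]
  [MeasurableSpace E] [BorelSpace E] {F : Type*} [NormedAddCommGroup F] [NormedSpace ℂ F]
  [CompleteSpace F]

/-- The blocks `j ≥ 1` through the inhomogeneous `q = ∞` Besov functional: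
`‖Δ̇_{n+1} u‖_{L^p} ≤ 2^{-(n+1)s} sup_m 2^{(m+1)s} ‖Δ̇_{m+1} u‖_{L^p}`. [folklore] -/
theorem eLpNormDistrib_lpBlock_succ_le (s : ℝ) (p : ℝ≥0∞) [Fact (1 ≤ p)] (u : 𝓢'(E, F)) (n : ℕ) :
    eLpNormDistrib p (lpBlock ((n : ℤ) + 1) u) ≤
      (2 : ℝ≥0∞) ^ (-((((n : ℤ) + 1 : ℤ) : ℝ) * s)) * eLpNorm (lpBlockWeightSucc s p u) ∞ Measure.count := by
  have h1 : lpBlockWeightSucc s p u n ≤ eLpNorm (lpBlockWeightSucc s p u) ∞ Measure.count := by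
    rw [eLpNorm_exponent_top, eLpNormEssSup_count]
    simp only [enorm_eq_self]
    exact le_iSup (fun n => lpBlockWeightSucc s p u n) n
  simp only [lpBlockWeightSucc, lpBlockWeight] at h1
  calc eLpNormDistrib p (lpBlock ((n : ℤ) + 1) u)
      = (2 : ℝ≥0∞) ^ (-((((n : ℤ) + 1 : ℤ) : ℝ) * s)) * ((2 : ℝ≥0∞) ^ ((((n : ℤ) + 1 : ℤ) : ℝ) * s) *
          eLpNormDistrib p (lpBlock ((n : ℤ) + 1) u)) := by
        rw [← mul_assoc, two_rpow_mul_two_rpow, neg_add_cancel, ENNReal.rpow_zero, one_mul]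
    _ ≤ _ := by gcongr

/-- `min(t, 1) ≤ t^s` for `t > 0` and `0 ≤ s ≤ 1`. [folklore] -/
theorem min_one_le_rpow {t s : ℝ} (ht : 0 < t) (hs₀ : 0 ≤ s) (hs₁ : s ≤ 1) : min t 1 ≤ t ^ s := by
  rcases le_or_gt t 1 with ht1 | ht1
  · rw [min_eq_left ht1]
    calc t = t ^ (1 : ℝ) := (Real.rpow_one t).symm
      _ ≤ t ^ s := Real.rpow_le_rpow_of_exponent_ge ht ht1 hs₁
  · rw [min_eq_right ht1.le]
    exact Real.one_le_rpow ht1.le hs₀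

/-- The coercion `L^∞ → 𝓢'` is additive (Mathlib's `Lp.toTemperedDistributionCLM`). [folklore] -/
theorem coe_add_toTemperedDistribution (a b : Lp F ∞ (volume : Measure E)) :
    (((a + b : Lp F ∞ (volume : Measure E))) : 𝓢'(E, F)) = (a : 𝓢'(E, F)) + (b : 𝓢'(E, F)) := by
  rw [← Lp.toTemperedDistributionCLM_apply, ← Lp.toTemperedDistributionCLM_apply,
    ← Lp.toTemperedDistributionCLM_apply, map_add]

/-- **`B^s_{∞,∞} ⊂ C^{0,s}_b` for `0 < s < 1`** (Triebel 1983, Thm. 2.5.7 (ii) with (2.5.7/9); the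
argument is Triebel's proof of Prop. 2.5.7, Step 1, `B⁰_{∞,1} ⊂ C`, run with the weights `2^{js}`):
a tempered distribution with `Ṡ₀ u ∈ L^∞` and `sup_{j ≥ 1} 2^{js} ‖Δ̇_j u‖_{L^∞} < ∞` is the
distribution of a
bounded `s`-Hölder function, namely `f = φ₀ + ∑_{j ≥ 1} φ_j` with the continuous representatives
`φ₀ = κ₁ ⋆ Ṡ₀ u`, `φ_j = (𝓕⁻¹ψ_j) ⋆ Δ̇_j u` (uniformly convergent series; `[f] = lim Ṡ_n u = u` in `𝓢'`);
the Hölder modulus is `∑_j min(C 2^j ‖h‖, 2) 2^{-js} ≲ ‖h‖^s`. [cite: Triebel1983, Thm. 2.5.7] -/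
theorem exists_memBoundedHolder_coe_eq_of_memBesov_top_top {s : ℝ} (hs₀ : 0 < s) (hs₁ : s < 1)
    (u : 𝓢'(E, F)) (hu : MemBesov s ∞ ∞ u) :
    ∃ (f : E → F) (hf : MemLp f ∞ (volume : Measure E)),
      MemBoundedHolder ⟨s, hs₀.le⟩ f ∧ ((hf.toLp f : Lp F ∞ (volume : Measure E)) : 𝓢'(E, F)) = u := by
  -- Step 0: the finite quantities `a₀ = ‖Ṡ₀ u‖_∞`, `N = sup_n 2^{(n+1)s} ‖Δ̇_{n+1} u‖_∞`
  have hfin : eLpNormDistrib ∞ (lowFreqCutoff 0 u) < ⊤ ∧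
      eLpNorm (lpBlockWeightSucc s ∞ u) ∞ Measure.count < ⊤ := ENNReal.add_lt_top.1 hu
  set a₀ : ℝ≥0∞ := eLpNormDistrib ∞ (lowFreqCutoff 0 u) with ha₀
  set N : ℝ≥0∞ := eLpNorm (lpBlockWeightSucc s ∞ u) ∞ Measure.count with hN
  have ha₀top : a₀ ≠ ⊤ := hfin.1.ne
  have hNtop : N ≠ ⊤ := hfin.2.ne
  set A : ℕ → ℝ≥0∞ := fun n => eLpNormDistrib ∞ (lpBlock ((n : ℤ) + 1) u) with hA
  have hAle : ∀ n, A n ≤ (2 : ℝ≥0∞) ^ (-((((n : ℤ) + 1 : ℤ) : ℝ) * s)) * N := fun n =>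
    eLpNormDistrib_lpBlock_succ_le s ∞ u n
  set ρ : ℝ≥0∞ := (2 : ℝ≥0∞) ^ (-s) with hρ
  have hρ1 : ρ < 1 := ENNReal.rpow_lt_one_of_one_lt_of_neg (by norm_num) (by linarith)
  have hpow : ∀ n : ℕ, (2 : ℝ≥0∞) ^ (-((((n : ℤ) + 1 : ℤ) : ℝ) * s)) = ρ ^ (n + 1) := by
    intro n
    rw [hρ, ← ENNReal.rpow_natCast, ← ENNReal.rpow_mul]
    congr 1
    push_cast
    ring
  have hAle' : ∀ n, A n ≤ ρ ^ (n + 1) * N := fun n => (hpow n) ▸ hAle n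
  have hAtop : ∀ n, A n ≠ ⊤ := fun n =>
    ne_top_of_le_ne_top (ENNReal.mul_ne_top (ENNReal.pow_ne_top hρ1.ne_top) hNtop) (hAle' n)
  have hsumA : ∑' n, A n ≠ ⊤ := by
    have h1 : ∑' n, A n ≤ ∑' n : ℕ, ρ ^ (n + 1) * N := ENNReal.tsum_le_tsum hAle'
    have h2 : ∑' n : ℕ, ρ ^ (n + 1) * N = ρ * (1 - ρ)⁻¹ * N := by
      rw [ENNReal.tsum_mul_right]
      congr 1
      simp_rw [pow_succ']
      rw [ENNReal.tsum_mul_left, ENNReal.tsum_geometric]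
    refine ne_top_of_le_ne_top ?_ (h1.trans_eq h2)
    exact ENNReal.mul_ne_top (ENNReal.mul_ne_top hρ1.ne_top
      (ENNReal.inv_ne_top.2 (tsub_pos_of_lt hρ1).ne')) hNtop
  -- Step 1: continuous representatives of `Ṡ₀ u` and of the blocks `Δ̇_{n+1} u`
  obtain ⟨g₀, hg₀⟩ := exists_coe_eq_of_eLpNormDistrib_lt_top hfin.1
  obtain ⟨φ₀, hφ₀c, hφ₀m, hφ₀rep⟩ :=
    exists_continuous_memLp_top_coe_eq_fourierMultiplierCLM (lowFreqSymbolSchwartz E 1) g₀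
  have hφ₀u : ((hφ₀m.toLp φ₀ : Lp F ∞ (volume : Measure E)) : 𝓢'(E, F)) = lowFreqCutoff 0 u := by
    rw [hφ₀rep, hg₀, coe_lowFreqSymbolSchwartz, ← lowFreqCutoff_apply, lowFreqCutoff_one_lowFreqCutoff_zero]
  have hblk : ∀ n : ℕ, ∃ φ : E → F, Continuous φ ∧ ∃ hφ : MemLp φ ∞ (volume : Measure E),
      ((hφ.toLp φ : Lp F ∞ (volume : Measure E)) : 𝓢'(E, F)) = lpBlock ((n : ℤ) + 1) u := by
    intro n
    obtain ⟨g, hg⟩ := exists_coe_eq_of_eLpNormDistrib_lt_top (lt_top_iff_ne_top.2 (hAtop n))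
    obtain ⟨Ψ, hΨ⟩ := exists_schwartzMap_coe_eq_bernsteinSymbol_rescaled (E := E) ((n : ℤ) + 1)
    obtain ⟨φ, hφc, hφm, hφrep⟩ := exists_continuous_memLp_top_coe_eq_fourierMultiplierCLM Ψ g
    refine ⟨φ, hφc, hφm, ?_⟩
    rw [hφrep, hg, hΨ, ← lpBlock_eq_fourierMultiplierCLM_bernsteinSymbol_rescaled]
  choose φ hφc hφm hφrep using hblk
  -- Step 2: pointwise bounds everywhere
  have hφ₀bd : ∀ x, ‖φ₀ x‖ₑ ≤ a₀ := fun x =>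
    (enorm_le_eLpNormDistrib_coe_toLp hφ₀c hφ₀m x).trans_eq (by rw [hφ₀u])
  have hφbd : ∀ n x, ‖φ n x‖ₑ ≤ A n := fun n x =>
    (enorm_le_eLpNormDistrib_coe_toLp (hφc n) (hφm n) x).trans_eq (by rw [hφrep n])
  have hφbd' : ∀ n x, ‖φ n x‖ ≤ (A n).toReal := fun n x => by
    rw [← toReal_enorm]
    exact ENNReal.toReal_mono (hAtop n) (hφbd n x)
  have hsum : Summable fun n => (A n).toReal := ENNReal.summable_toReal hsumA
  have hφsum : ∀ x, Summable fun n => φ n x := fun x => Summable.of_norm_bounded hsum fun n => hφbd' n x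
  -- Step 3: the function
  set f : E → F := fun x => φ₀ x + ∑' n, φ n x with hf_def
  set Bsum : ℝ := a₀.toReal + ∑' n, (A n).toReal with hBsum
  have hfB : ∀ x, ‖f x‖ ≤ Bsum := fun x => by
    have hs' : Summable fun n => ‖φ n x‖ :=
      hsum.of_nonneg_of_le (fun n => norm_nonneg _) fun n => hφbd' n x
    calc ‖f x‖ ≤ ‖φ₀ x‖ + ‖∑' n, φ n x‖ := norm_add_le _ _
      _ ≤ a₀.toReal + ∑' n, (A n).toReal := by
          refine add_le_add ?_ ((norm_tsum_le_tsum_norm hs').trans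
            (Summable.tsum_le_tsum (fun n => hφbd' n x) hs' hsum))
          rw [← toReal_enorm]
          exact ENNReal.toReal_mono ha₀top (hφ₀bd x)
  -- Step 4: the Hölder modulus
  obtain ⟨C₁, hC₁⟩ := exists_eLpNormDistrib_translSymbol_sub_one_lpBlock_le (E := E) (F := F) ∞
  obtain ⟨C₂, hC₂⟩ := exists_eLpNormDistrib_translSymbol_sub_one_lowFreqCutoff_zero_le (E := E) (F := F) ∞
  obtain ⟨K, hKtop, hK⟩ := exists_tsum_min_mul_rpow_neg_le hs₀ hs₁
  set C' : ℝ≥0∞ := max (max (C₁ : ℝ≥0∞) C₂) 2 with hC'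
  have hC'top : C' ≠ ⊤ := by simp [hC']
  have hC₁' : (C₁ : ℝ≥0∞) ≤ C' := (le_max_left _ _).trans (le_max_left _ _)
  have hC₂' : (C₂ : ℝ≥0∞) ≤ C' := (le_max_right _ _).trans (le_max_left _ _)
  have h2' : (2 : ℝ≥0∞) ≤ C' := le_max_right _ _
  set L : ℝ≥0∞ := C' * (a₀ + N * K) * ENNReal.ofReal ((2 * π) ^ s) with hL
  have hLtop : L ≠ ⊤ := ENNReal.mul_ne_top (ENNReal.mul_ne_top hC'top
    (ENNReal.add_ne_top.2 ⟨ha₀top, ENNReal.mul_ne_top hNtop hKtop⟩)) ENNReal.ofReal_ne_top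
  have hHolder : ∀ x h : E, ‖f (x + h) - f x‖ₑ ≤ L * ‖h‖ₑ ^ s := by
    intro x h
    rcases eq_or_ne h 0 with rfl | hh
    · simp
    set t : ℝ := 2 * π * ‖h‖ with ht
    have htpos : 0 < t := mul_pos Real.two_pi_pos (norm_pos_iff.2 hh)
    -- the blocks
    have hterm : ∀ n : ℕ, ‖φ n (x + h) - φ n x‖ₑ ≤ C' * N * ENNReal.ofReal (t ^ s) *
        ENNReal.ofReal (min ((2 : ℝ) ^ ((n : ℤ) + 1) * t) 1 * ((2 : ℝ) ^ ((n : ℤ) + 1) * t) ^ (-s)) := by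
      intro n
      refine (enorm_sub_le_eLpNormDistrib_translSymbol_sub_one_coe_toLp (hφc n) (hφm n) h x).trans ?_
      rw [hφrep n]
      have hAn := hAle n
      simp only [hA] at hAn
      set j : ℤ := (n : ℤ) + 1 with hj
      have hmin : eLpNormDistrib ∞ (fourierMultiplierCLM F (fun ξ : E => translSymbol h ξ - 1) (lpBlock j u)) ≤
          C' * ENNReal.ofReal (min ((2 : ℝ) ^ j * t) 1) * eLpNormDistrib ∞ (lpBlock j u) := by
        rcases le_or_gt ((2 : ℝ) ^ j * t) 1 with hjt | hjt
        · rw [min_eq_left hjt]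
          have ha : 2 * π * ((2 : ℝ) ^ j * ‖h‖) ≤ 1 := by
            rwa [show 2 * π * ((2 : ℝ) ^ j * ‖h‖) = (2 : ℝ) ^ j * t by rw [ht]; ring]
          calc _ ≤ C₁ * ENNReal.ofReal (2 * π * ((2 : ℝ) ^ j * ‖h‖)) * eLpNormDistrib ∞ (lpBlock j u) :=
                hC₁ h j ha _
            _ ≤ C' * ENNReal.ofReal ((2 : ℝ) ^ j * t) * eLpNormDistrib ∞ (lpBlock j u) := by
                rw [show 2 * π * ((2 : ℝ) ^ j * ‖h‖) = (2 : ℝ) ^ j * t by rw [ht]; ring]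
                gcongr
        · rw [min_eq_right hjt.le, ENNReal.ofReal_one, mul_one]
          calc _ ≤ 2 * eLpNormDistrib ∞ (lpBlock j u) := eLpNormDistrib_translSymbol_sub_one_le_two_mul h _
            _ ≤ C' * eLpNormDistrib ∞ (lpBlock j u) := by gcongr
      refine hmin.trans ?_
      have h2 : (2 : ℝ≥0∞) ^ (-((j : ℝ) * s)) =
          ENNReal.ofReal (t ^ s) * ENNReal.ofReal (((2 : ℝ) ^ j * t) ^ (-s)) := by
        rw [show -((j : ℝ) * s) = (j : ℝ) * (-s) by ring, ← ofReal_two_zpow_rpow,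
          two_zpow_rpow_neg_eq j s htpos, ENNReal.ofReal_mul (by positivity)]
      calc C' * ENNReal.ofReal (min ((2 : ℝ) ^ j * t) 1) * eLpNormDistrib ∞ (lpBlock j u)
          ≤ C' * ENNReal.ofReal (min ((2 : ℝ) ^ j * t) 1) * ((2 : ℝ≥0∞) ^ (-((j : ℝ) * s)) * N) := by
            gcongr
        _ = C' * N * ENNReal.ofReal (t ^ s) *
            (ENNReal.ofReal (min ((2 : ℝ) ^ j * t) 1) * ENNReal.ofReal (((2 : ℝ) ^ j * t) ^ (-s))) := by
            rw [h2]; ring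
        _ = C' * N * ENNReal.ofReal (t ^ s) *
            ENNReal.ofReal (min ((2 : ℝ) ^ j * t) 1 * ((2 : ℝ) ^ j * t) ^ (-s)) := by
            rw [← ENNReal.ofReal_mul (le_min (by positivity) zero_le_one)]
    -- summing the blocks
    have hds : Summable fun n => ‖φ n (x + h) - φ n x‖ :=
      (hsum.add hsum).of_nonneg_of_le (fun n => norm_nonneg _) fun n =>
        (norm_sub_le _ _).trans (add_le_add (hφbd' n (x + h)) (hφbd' n x))
    have hdiff_tsum : ‖(∑' n, φ n (x + h)) - ∑' n, φ n x‖ₑ ≤ ∑' n, ‖φ n (x + h) - φ n x‖ₑ := by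
      rw [← Summable.tsum_sub (hφsum (x + h)) (hφsum x)]
      calc ‖∑' n, (φ n (x + h) - φ n x)‖ₑ = ENNReal.ofReal ‖∑' n, (φ n (x + h) - φ n x)‖ :=
            (ofReal_norm _).symm
        _ ≤ ENNReal.ofReal (∑' n, ‖φ n (x + h) - φ n x‖) :=
            ENNReal.ofReal_le_ofReal (norm_tsum_le_tsum_norm hds)
        _ = ∑' n, ENNReal.ofReal ‖φ n (x + h) - φ n x‖ :=
            ENNReal.ofReal_tsum_of_nonneg (fun n => norm_nonneg _) hds
        _ = ∑' n, ‖φ n (x + h) - φ n x‖ₑ := by simp_rw [ofReal_norm]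
    have hsumterm : ∑' n, ‖φ n (x + h) - φ n x‖ₑ ≤ C' * N * ENNReal.ofReal (t ^ s) * K := by
      calc ∑' n, ‖φ n (x + h) - φ n x‖ₑ
          ≤ ∑' n : ℕ, C' * N * ENNReal.ofReal (t ^ s) *
              ENNReal.ofReal (min ((2 : ℝ) ^ ((n : ℤ) + 1) * t) 1 * ((2 : ℝ) ^ ((n : ℤ) + 1) * t) ^ (-s)) :=
            ENNReal.tsum_le_tsum hterm
        _ = C' * N * ENNReal.ofReal (t ^ s) * ∑' n : ℕ,
              ENNReal.ofReal (min ((2 : ℝ) ^ ((n : ℤ) + 1) * t) 1 * ((2 : ℝ) ^ ((n : ℤ) + 1) * t) ^ (-s)) := by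
            rw [ENNReal.tsum_mul_left]
        _ ≤ C' * N * ENNReal.ofReal (t ^ s) *
              ∑' j : ℤ, ENNReal.ofReal (min ((2 : ℝ) ^ j * t) 1 * ((2 : ℝ) ^ j * t) ^ (-s)) := by
            gcongr
            exact ENNReal.tsum_comp_le_tsum_of_injective (f := fun n : ℕ => (n : ℤ) + 1)
              (fun a b hab => by simpa using hab)
              (fun j : ℤ => ENNReal.ofReal (min ((2 : ℝ) ^ j * t) 1 * ((2 : ℝ) ^ j * t) ^ (-s)))
        _ ≤ C' * N * ENNReal.ofReal (t ^ s) * K := by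
            gcongr
            exact hK t htpos
    -- the low frequencies
    have hts : ENNReal.ofReal (min t 1) ≤ ENNReal.ofReal (t ^ s) :=
      ENNReal.ofReal_le_ofReal (min_one_le_rpow htpos hs₀.le hs₁.le)
    have hlow : ‖φ₀ (x + h) - φ₀ x‖ₑ ≤ C' * a₀ * ENNReal.ofReal (t ^ s) := by
      refine (enorm_sub_le_eLpNormDistrib_translSymbol_sub_one_coe_toLp hφ₀c hφ₀m h x).trans ?_
      rw [hφ₀u]
      rcases le_or_gt t 1 with ht1 | ht1
      · have ht' : ENNReal.ofReal t ≤ ENNReal.ofReal (t ^ s) := by rwa [min_eq_left ht1] at hts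
        calc _ ≤ C₂ * ENNReal.ofReal t * a₀ := hC₂ h ht1 u
          _ ≤ C' * ENNReal.ofReal (t ^ s) * a₀ := by gcongr
          _ = C' * a₀ * ENNReal.ofReal (t ^ s) := by ring
      · calc _ ≤ 2 * a₀ := eLpNormDistrib_translSymbol_sub_one_le_two_mul h _
          _ = 2 * a₀ * ENNReal.ofReal (min t 1) := by rw [min_eq_right ht1.le, ENNReal.ofReal_one, mul_one]
          _ ≤ C' * a₀ * ENNReal.ofReal (t ^ s) := by gcongr
    -- conclusion
    calc ‖f (x + h) - f x‖ₑ
        = ‖(φ₀ (x + h) - φ₀ x) + ((∑' n, φ n (x + h)) - ∑' n, φ n x)‖ₑ := by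
          congr 1
          simp only [hf_def]
          abel
      _ ≤ ‖φ₀ (x + h) - φ₀ x‖ₑ + ‖(∑' n, φ n (x + h)) - ∑' n, φ n x‖ₑ := enorm_add_le _ _
      _ ≤ C' * a₀ * ENNReal.ofReal (t ^ s) + C' * N * ENNReal.ofReal (t ^ s) * K :=
          add_le_add hlow (hdiff_tsum.trans hsumterm)
      _ = C' * (a₀ + N * K) * ENNReal.ofReal (t ^ s) := by ring
      _ = L * ‖h‖ₑ ^ s := by
          rw [hL, ht, Real.mul_rpow Real.two_pi_pos.le (norm_nonneg _), ENNReal.ofReal_mul (by positivity),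
            ← ENNReal.ofReal_rpow_of_nonneg (norm_nonneg _) hs₀.le, ofReal_norm]
          ring
  -- Step 5: `f ∈ C^{0,s}_b ∩ L^∞`
  have hHW : HolderWith L.toNNReal ⟨s, hs₀.le⟩ f := by
    intro x y
    rw [ENNReal.coe_toNNReal hLtop, edist_eq_enorm_sub, edist_eq_enorm_sub]
    have := hHolder y (x - y)
    rwa [add_sub_cancel] at this
  have hr : (0 : ℝ≥0) < ⟨s, hs₀.le⟩ := hs₀
  have hfc : Continuous f := hHW.continuous hr
  have hfm : MemLp f ∞ (volume : Measure E) :=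
    memLp_top_of_bound hfc.aestronglyMeasurable Bsum (Eventually.of_forall hfB)
  refine ⟨f, hfm, memBoundedHolder_iff.2 ⟨⟨Bsum, hfB⟩, ⟨L.toNNReal, hHW⟩⟩, ?_⟩
  -- Step 6: `[f] = u`: the partial sums represent `Ṡ_m u → u`, and converge to `f` in `L^∞`
  set Fm : ℕ → E → F := fun m x => φ₀ x + ∑ n ∈ Finset.range m, φ n x with hFm
  have hFm_mem : ∀ m, MemLp (Fm m) ∞ (volume : Measure E) := fun m =>
    hφ₀m.add (memLp_finsetSum _ (fun n _ => hφm n))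
  have hFm_coe : ∀ m : ℕ, (((hFm_mem m).toLp (Fm m) : Lp F ∞ (volume : Measure E)) : 𝓢'(E, F)) =
      lowFreqCutoff (m : ℤ) u := by
    intro m
    induction m with
    | zero =>
        have h0 : (hFm_mem 0).toLp (Fm 0) = hφ₀m.toLp φ₀ := by
          rw [MemLp.toLp_eq_toLp_iff]
          exact Eventually.of_forall fun x => by simp [hFm]
        rw [h0, hφ₀u, Nat.cast_zero]
    | succ m ih =>
        have h1 : (hFm_mem (m + 1)).toLp (Fm (m + 1)) = (hFm_mem m).toLp (Fm m) + (hφm m).toLp (φ m) := by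
          rw [← MemLp.toLp_add, MemLp.toLp_eq_toLp_iff]
          exact Eventually.of_forall fun x => by simp [hFm, Finset.sum_range_succ, add_assoc]
        rw [h1, coe_add_toTemperedDistribution, ih, hφrep m, lpBlock_eq_sub_holds ((m : ℤ) + 1),
          FunLike.coe_sub, Pi.sub_apply, add_sub_cancel_right, Nat.cast_succ, add_sub_cancel]
  have hlim1 : Tendsto (fun m : ℕ => (((hFm_mem m).toLp (Fm m) : Lp F ∞ (volume : Measure E)) : 𝓢'(E, F)))
      atTop (𝓝 u) := by
    simp_rw [hFm_coe]
    exact (tendsto_lowFreqCutoff_atTop_distribution u).comp tendsto_natCast_atTop_atTop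
  have hdist : ∀ m, ‖(hFm_mem m).toLp (Fm m) - hfm.toLp f‖ ≤ ∑' k, (A (k + m)).toReal := by
    intro m
    have hsA : Summable fun k => (A (k + m)).toReal :=
      (summable_nat_add_iff (f := fun n => (A n).toReal) m).2 hsum
    have hpt : ∀ x, ‖(Fm m - f) x‖ ≤ ∑' k, (A (k + m)).toReal := by
      intro x
      have hsk : Summable fun k => ‖φ (k + m) x‖ :=
        hsA.of_nonneg_of_le (fun k => norm_nonneg _) fun k => hφbd' (k + m) x
      have heq : (Fm m - f) x = -∑' k, φ (k + m) x := by
        simp only [Pi.sub_apply, hFm, hf_def]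
        rw [← Summable.sum_add_tsum_nat_add m (hφsum x)]
        abel
      rw [heq, norm_neg]
      exact (norm_tsum_le_tsum_norm hsk).trans (Summable.tsum_le_tsum (fun k => hφbd' (k + m) x) hsk hsA)
    rw [← MemLp.toLp_sub, Lp.norm_toLp]
    refine ENNReal.toReal_le_of_le_ofReal (tsum_nonneg fun k => ENNReal.toReal_nonneg) ?_
    rw [eLpNorm_exponent_top]
    exact eLpNormEssSup_le_of_ae_bound (Eventually.of_forall hpt)
  have htail : Tendsto (fun m : ℕ => ∑' k, (A (k + m)).toReal) atTop (𝓝 0) :=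
    tendsto_sum_nat_add fun n => (A n).toReal
  have hlim2 : Tendsto (fun m : ℕ => ((hFm_mem m).toLp (Fm m) : Lp F ∞ (volume : Measure E))) atTop
      (𝓝 (hfm.toLp f)) := by
    rw [tendsto_iff_norm_sub_tendsto_zero]
    exact squeeze_zero (fun m => norm_nonneg _) hdist htail
  have hlim3 : Tendsto (fun m : ℕ => (((hFm_mem m).toLp (Fm m) : Lp F ∞ (volume : Measure E)) : 𝓢'(E, F)))
      atTop (𝓝 ((hfm.toLp f : Lp F ∞ (volume : Measure E)) : 𝓢'(E, F))) :=
    ((Lp.toTemperedDistributionCLM F (volume : Measure E) ∞).continuous.tendsto _).comp hlim2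
  exact tendsto_nhds_unique hlim3 hlim1

/-! ## The characterisation -/

/-- **Discharge of the named fact `memBesov_top_top_iff_memBoundedHolder`: `B^s_{∞,∞} = C^{0,s}_b`
for `0 < s < 1`** (Triebel 1983, Thm. 2.5.7 (ii): `𝒞^s(ℝⁿ) = B^s_{∞,∞}(ℝⁿ)` for `s > 0`, together
with (2.5.7/9): `C^s(ℝⁿ) = 𝒞^s(ℝⁿ)` for `0 < s ∉ ℕ`, where `C^s` (`0 < s < 1`) is the space of bounded
uniformly continuous `f` with `sup_{x ≠ y} |f(x) - f(y)|/|x - y|^s < ∞`, (2.2.2/3); equivalently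
Cor. 2.5.12 (ii), eq. (22). Held copy: PDF pp. 218–220 and 245.) A tempered distribution `u` lies in
`B^s_{∞,∞}` (finite `‖Ṡ₀ u‖_{L^∞} + sup_{j ≥ 1} 2^{js} ‖Δ̇_j u‖_{L^∞}`) iff it is the distribution of
a bounded `s`-Hölder function (`exists_memBoundedHolder_coe_eq_of_memBesov_top_top`,
`memBesov_top_top_coe_of_memBoundedHolder`). The proof is dimension-free (also `E = {0}`).
[cite: Triebel1983, Thm. 2.5.7] -/
theorem memBesov_top_top_iff_memBoundedHolder_holds :
    memBesov_top_top_iff_memBoundedHolder (E := E) (F := F) := by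
  intro s hs₀ hs₁ u
  constructor
  · exact exists_memBoundedHolder_coe_eq_of_memBesov_top_top hs₀ hs₁ u
  · rintro ⟨f, hf, hH, rfl⟩
    exact memBesov_top_top_coe_of_memBoundedHolder hs₀ hf hH

end BesovToHolder

end Literature.Analysis.FunctionSpaces
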